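import Mathlib
import HarnessLib

/-!
# Cell pnp-psdrank, route `ChebyshevTracialDesign`: LEVEL-SET MIXTURE BOUND — the per-matching positive part of the design value of a
# mask that is a function of a statistic `φ` is at most the `g`-mixture of the positive parts of its LEVEL SETS
# (crux `TracialDecayExp20`, stmt-PneNP-19878; eng MEMO-18 (eng g19) §1.2 / §5 (P1))

Engine brick (eng g19), theorems only (no definitions), stated over arbitrary finite index types so that it applies verbatim
to every functional of the r-free ladder (prover MEMO-21 §3(b)–(c')): for a weight `W U M`, a kernel `k U M` (e.g. `(v_M · c_U)²`
for the pair-containment form (CG_1'), `(v_M · x_U)²` for CG_1, `1` for CG_0 = NTF) and a mask `f = g ∘ φ` that factors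
through a statistic `φ` (e.g. `φ U = |U ∩ H|`, or `φ U = cc(U, M₀)` for a second matching `M₀`) with `0 ≤ g`:
* §1 `apply_comp_eq_sum_ite` / `sum_mul_comp_mul_eq` — per matching, the value of `g ∘ φ` is the `g`-mixture of the values
  of the level sets `1[φ = s]`;
* §2 `posPart_sum_mul_le` — `max (Σ_s g s · a s) 0 ≤ Σ_s g s · max (a s) 0` for `0 ≤ g`;
* §3 **`sum_posPart_comp_le`** — `Σ_M (Σ_U W U M · g(φ U) · k U M)⁺ ≤ Σ_s g s · Σ_M (Σ_U W U M · 1[φ U = s] · k U M)⁺`, and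
  **`sum_posPart_comp_le_sum`** — with `g ≤ 1` and level-set bounds `B s`, `… ≤ Σ_s B s`: the defect of EVERY `φ`-measurable
  `[0,1]`-mask is bounded by the SUM OF THE LEVEL-SET DEFECTS (MEMO-18's mask-free bounds `U(n,h)`, `U^{pp}` are exactly these sums).
[folklore] (positive homogeneity and subadditivity of the positive part).
Stature: support/instrument (bookkeeping glue). WHAT THIS IS NOT: no statement about designs, no bound on any level-set defect, no
P-vs-NP content. Supports stmt-PneNP-19878.
-/

set_option linter.dupNamespace false -- `Summit.PneNP.PneNP.…`: summit = sub-problem (D-0017)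

namespace Summit.PneNP.PneNP.Theorems.ChebyshevTracialDesignLevelSetMixture

open Finset

variable {α β ι : Type*} [Fintype α] [Fintype β] [Fintype ι] [DecidableEq ι]

/-! ### §1 A function of a statistic is the mixture of its level sets -/

omit [Fintype α] in
/-- `g (φ a) = Σ_s 1[φ a = s]·g s` over a finite range type. [folklore] -/
theorem apply_comp_eq_sum_ite (g : ι → ℝ) (φ : α → ι) (a : α) :
    g (φ a) = ∑ s, (if φ a = s then (1 : ℝ) else 0) * g s := by
  simp [Finset.sum_ite_eq]

/-- Per matching `M`: `Σ_U W U · (g(φ U) · k U) = Σ_s g s · Σ_U W U · (1[φ U = s] · k U)`. [folklore] -/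
theorem sum_mul_comp_mul_eq (W k : α → ℝ) (g : ι → ℝ) (φ : α → ι) :
    ∑ U, W U * (g (φ U) * k U) = ∑ s, g s * ∑ U, W U * ((if φ U = s then (1 : ℝ) else 0) * k U) := by
  have h : ∀ U, W U * (g (φ U) * k U) = ∑ s, g s * (W U * ((if φ U = s then (1 : ℝ) else 0) * k U)) := by
    intro U
    rw [apply_comp_eq_sum_ite g φ U, Finset.sum_mul, Finset.mul_sum]
    refine Finset.sum_congr rfl fun s _ => ?_
    ring
  simp_rw [h]
  rw [Finset.sum_comm]
  refine Finset.sum_congr rfl fun s _ => ?_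
  rw [Finset.mul_sum]

/-! ### §2 Positive part of a nonnegative mixture -/

omit [Fintype ι] [DecidableEq ι] in
/-- For `0 ≤ g`: `max (Σ_s g s · a s) 0 ≤ Σ_s g s · max (a s) 0`. [folklore] -/
theorem posPart_sum_mul_le (S : Finset ι) (g a : ι → ℝ) (hg : ∀ s, 0 ≤ g s) :
    max (∑ s ∈ S, g s * a s) 0 ≤ ∑ s ∈ S, g s * max (a s) 0 := by
  refine max_le ?_ ?_
  · exact Finset.sum_le_sum fun s _ => mul_le_mul_of_nonneg_left (le_max_left _ _) (hg s)
  · exact Finset.sum_nonneg fun s _ => mul_nonneg (hg s) (le_max_right _ _)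

/-! ### §3 The level-set mixture bound for the per-matching positive parts -/

/-- MAIN: for every weight `W`, kernel `k`, statistic `φ` and `0 ≤ g`,
`Σ_M max(Σ_U W U M · (g(φ U) · k U M), 0) ≤ Σ_s g s · Σ_M max(Σ_U W U M · (1[φ U = s] · k U M), 0)`. [folklore] -/
theorem sum_posPart_comp_le (W k : α → β → ℝ) (g : ι → ℝ) (φ : α → ι) (hg : ∀ s, 0 ≤ g s) :
    ∑ M, max (∑ U, W U M * (g (φ U) * k U M)) 0 ≤
      ∑ s, g s * ∑ M, max (∑ U, W U M * ((if φ U = s then (1 : ℝ) else 0) * k U M)) 0 := by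
  calc ∑ M, max (∑ U, W U M * (g (φ U) * k U M)) 0
      = ∑ M, max (∑ s, g s * ∑ U, W U M * ((if φ U = s then (1 : ℝ) else 0) * k U M)) 0 := by
        refine Finset.sum_congr rfl fun M _ => ?_
        rw [sum_mul_comp_mul_eq (fun U => W U M) (fun U => k U M) g φ]
    _ ≤ ∑ M, ∑ s, g s * max (∑ U, W U M * ((if φ U = s then (1 : ℝ) else 0) * k U M)) 0 :=
        Finset.sum_le_sum fun M _ => posPart_sum_mul_le _ _ _ hg
    _ = ∑ s, g s * ∑ M, max (∑ U, W U M * ((if φ U = s then (1 : ℝ) else 0) * k U M)) 0 := by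
        rw [Finset.sum_comm]
        refine Finset.sum_congr rfl fun s _ => ?_
        rw [Finset.mul_sum]

/-- COROLLARY (the mask-free bound): if moreover `g ≤ 1` and every level set obeys `Σ_M max(…, 0) ≤ B s`, then the `φ`-measurable mask
`g ∘ φ` obeys `Σ_M max(…, 0) ≤ Σ_s B s`. [folklore] -/
theorem sum_posPart_comp_le_sum (W k : α → β → ℝ) (g : ι → ℝ) (φ : α → ι) (hg : ∀ s, 0 ≤ g s) (hg1 : ∀ s, g s ≤ 1)
    (B : ι → ℝ) (hB : ∀ s, ∑ M, max (∑ U, W U M * ((if φ U = s then (1 : ℝ) else 0) * k U M)) 0 ≤ B s) :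
    ∑ M, max (∑ U, W U M * (g (φ U) * k U M)) 0 ≤ ∑ s, B s := by
  refine (sum_posPart_comp_le W k g φ hg).trans (Finset.sum_le_sum fun s _ => ?_)
  have h0 : 0 ≤ ∑ M, max (∑ U, W U M * ((if φ U = s then (1 : ℝ) else 0) * k U M)) 0 :=
    Finset.sum_nonneg fun M _ => le_max_right _ _
  calc g s * ∑ M, max (∑ U, W U M * ((if φ U = s then (1 : ℝ) else 0) * k U M)) 0
      ≤ 1 * ∑ M, max (∑ U, W U M * ((if φ U = s then (1 : ℝ) else 0) * k U M)) 0 :=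
        mul_le_mul_of_nonneg_right (hg1 s) h0
    _ ≤ B s := by rw [one_mul]; exact hB s

end Summit.PneNP.PneNP.Theorems.ChebyshevTracialDesignLevelSetMixture
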